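import Mathlib
import HarnessLib
import HarnessLib.Audit
import Summits.PneNP.Statement
import Literature.Computability.Complexity.CookBridges
import Literature.Computability.Complexity.Promise
import Literature.Computability.MetaComplexity.MCSP
import Literature.Computability.MetaComplexity.FormulaModelsAE
import Literature.Computability.MetaComplexity.OliveiraPichSanthanam2019.GapMCSPMagnification
import Literature.Computability.MetaComplexity.MagnificationGapCensus
import Literature.Computability.MetaComplexity.GapMCSPLightConeLowerBound
import HarnessLib.Audit.Status.Attr

/-!
Route: RootDecompMagnificationPayout

Root-decomposition cell decomp-pnenp (D-0178), node N40 = proposal P39 (lens-1 gen 10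
«RootDecompMagnificationPayout / WHICH MAGNIFICATION PAYS WHAT»,
HOME/decomp-pnenp-lens-1/MagnificationPayout.lean sha256 b36e8d94; critic CLEARED
2026-08-30T09:05:37Z on both legs, W1 thin route, LOW priority, q := 1 fixed). It suffices to show
the two law-D pieces of the cut of P ≠ NP at the bit Y(1) «gap-MCSP[2^{βn}/(cn), 2^{βn}] has no B₂
circuits of N·⌊log₂N⌋ + 1 gates (∀ c ≥ 1, cofinally small β)»: CircuitWindowShadowOne «¬S ⟹ Y(1)»
(attacked; located S-free sub-target = Y(1), an explicit super-linear B₂ lower bound strictly inside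
the (N − o(N), N^{1+ε}) gap: floor PROVED = aside WindowFloor, threshold ⟹ cell PROVED = aside
WindowBelowThreshold) and CircuitWindowLiftOne «¬S ⟹ ¬Y(1)» ⟺ «Y(1) ⟹ S» (declared residual:
hardness magnification AT THE WINDOW, below OPS Thm 1.4's threshold; pre-costume in expectation). S
⟺ ShadowOne ∧ LiftOne hypothesis-free (pack pneNP_iff). The node also delivers LAW (x)
«magnification payout» in kernel: IDLE payouts make lifts and law-D shadows costume, OVERSHOOT
payouts make threshold shadows costume — so a magnification axis carries a located cell only
strictly below an EXACT/OVERSHOOT threshold, which is where this cut sits. DECISION AT q = 0 (rev 1;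
lens-1 g13 «TradeOffLaw», HOME/decomp-pnenp-lens-1/TradeOffLaw.lean 880b490f, critic NODE-VERDICT
2026-08-30T13:09:32Z CLEARED as the decision node of the q = 0 leaf): CircuitWindowCell 0 is PROVED
hypothesis-free (size–acceptance trade-off G ≥ N + N/(9L) − L − 3, L = ⌊log₂ acc⌋, for every
B₂-circuit accepting the weight-≤1 ball; record aside WindowCellZero, a BC5 rung strictly above
WindowFloor), so at q = 0 the bet is decided (Lift 0 ↔ S, Shadow 0 free) and what is open of
ShadowOne's S-free core Y(1) is exactly the dial step N ↦ N·log N + 1; the q = 1 door and its tags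
are UNCHANGED (32096 WEAKER·UNDECIDED·ATTACKABLE·IDEA-NEEDED, inside the weight-one/sparsity method
ceiling N + O(N/L) — Cell 1 needs the full YES structure; 32097 residual, pre-costume in
expectation). ‖ REV 2 (writer g10, 2-SEAT WATCH of OPS 13:27:59Z; record + tribunal_fit only): the q
= 0 cell is now a TREE THEOREM — aside WindowCellZero (stmt-PneNP-33309) LANDED·CLOSED·proved
2026-08-30T14:23:38Z by Summit.PneNP.PneNP.Theorems.windowCellZero_proof (p776364, census-1 g16;
nine-module chain Theorems/GapMCSPWindowCellZero{Formulas, Counting, FlipLaw, Unfolding, Potential,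
Relevance, Product, Count}.lean + GapMCSPWindowCellZero.lean p775250–p776212 --supports 32096:
trade-off law `GapMCSPWindowCellZero.tradeOffLaw_holds` (c = 9, hypothesis-free) and payout
`GapMCSPWindowCellZero.gapMCSP_R3_not_mem_SIZEae_id` «Gap-MCSP[2^{βn}/(cn), 2^{βn}] ∉ promiseLift
(SIZEae fun N => N)», ∀ c ≥ 1, 0 < β < 1/3; critic g6 TREE-CERTIFIED 14:38:53Z, probe
Tree_WindowCellZero_p776364_probe.lean 16/16 AXOK) ⇒ the BC5 WITNESS OF RECORD moves UP from the
floor (Literature.Computability.MetaComplexity.gapMCSP_not_mem_SIZEae_sublinear, N − ⌈N^{β′}⌉ =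
aside WindowFloor) to the q = 0 cell (tribunal_fit.witness :=
Summit.PneNP.PneNP.Theorems.windowCellZero_proof, typed by the route decl WindowCellZero — announced
in rev 1's note «then the witness may move up to the q = 0 cell»); residual CircuitWindowLiftOne
(FULLY QUALIFIED) and method family UNCHANGED; door, statements, cone {32096, 32097}, closes,
imports UNCHANGED; 32096 / 32097 / 32100 OPEN (an aside closes no door). P ≠ NP is not proved by
anything here.
Lean: CircuitWindowShadowOne → CircuitWindowLiftOne → PneNP

Rationale: WHY THIS LINE. Hardness magnification (OPS, MMW, CJW, CHOPRS) is the one modern programme that turns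
WEAK explicit lower bounds into P ≠ NP-strength separations, and the cell had no law telling which
magnification theorems can carry a decomposition of S. LAW (x), proved hypothesis-free in the lens
(§1–§4, 58 theorems in the critic's sweep), classifies every typed census row by PAYOUT: IDLE (¬S →
W: NP ⊄ SIZE[n^k] via Kannan + collapse, the EXP rows, fixed-polynomial formula / BP / TC_d rows) ⟹
every lift below is COSTUME and every law-D shadow is COSTUME (located costumes verdict_R42 / R54 /
R24 / EXP rows); EXACT / OVERSHOOT (P ≠ NP; NP ⊄ P/poly) ⟹ the shadow AT threshold is COSTUME
(verdict_R3 / R4 / R55 / R5) — hence the only admissible cells sit STRICTLY BELOW an exact/overshoot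
threshold. The NEW LEVER is that placement made concrete on the one OVERSHOOT axis without a cell:
the general-B₂ size of OPS's gap-MCSP[2^{βn}/(cn), 2^{βn}], cut at the window N log N, calibrated in
kernel between the PROVED floor N − ⌈N^{β′}⌉ (tree light-cone counting theorem) and the printed
threshold N^{1+ε} (cell_of_gap_R3), non-vacuous, antitone dial in q. Imported: hardness
magnification (OPS Thm 1.4, MMW Thm 1.3/1.4, CJW Thm 1.1.1), the locality barrier (CHOPRS20),
gate-elimination limits (GHKK16), the tree's gap-MCSP light-cone lower bound, law D.
RANKED CRUXES. r2 CircuitWindowShadowOne (attacked; located target Y(1); frontier family F_B2 shared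
with N36 QuadLinLB, distinct coordinate). r3 CircuitWindowLiftOne (declared residual; pre-costume in
expectation; test T2). Asides (never staffed, both PROVED in the pack): WindowFloor (BC5 floor rung
= tree gapMCSP_not_mem_SIZEae_sublinear), WindowBelowThreshold (gap_R3 ⟹ Y(1)). Rev 1: +
WindowCellZero (the q = 0 cell «no B₂ circuits of eventually ≤ N gates», PROVED by lens-1 g13
TradeOffLaw c = 9, critic CLEARED 13:09:32Z; BC5 rung strictly between WindowFloor and the crux;
Theorems landing GapMCSPWindowCellZero.lean --supports 32096 endorsed, lint caveats in the verdict).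
Rev 2: WindowCellZero (33309) CLOSED·proved by the tree theorem windowCellZero_proof (p776364; chain
p775250–p776212, 0 lint warnings) = the BC5 witness of record (tribunal_fit.witness), strictly
between WindowFloor and the crux's S-free core Y(1). Not filed: the LAW (x) theorems (lens §1–§4,
hypothesis-free kernel facts, cited by name: lift_costume_of_idle, lawD_costume_of_idle,
shadow_costume_of_overshoot, idle_NPNotInFixedPolySize, verdict_R42 …), hub item 13658 (exact
MCSP[s] at the MMW threshold — costume by LAW (x) at threshold, by name), the binder-discharge
asides T4 (FORMULAae / BPSIZEae / TCdWIRESae ⊆ SIZE, E ⊆ PPoly → EXP ⊆ PPoly; provable-now, left to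
the census), the other dial cells q ≥ 2.
KILL CRITERIA. (k1) T1 decided YES (¬Y(1) derived from NP ⊆ P: an N log N-gate separator for
gap-MCSP in Algorithmica): ShadowOne ≡ S — retire located-costume; (k2) T2 decided YES in print
(magnification for gap-MCSP[2^{βn}] from N·polylog general-circuit size): LiftOne becomes a print
theorem, the cell moves to threshold and its shadow is COSTUME by LAW (x) — re-cut lower on the dial
(N + N^{γ}-type budgets, cell_anti) or retire; (k3) a proof of Y(1) outright closes ShadowOne and
makes LiftOne ≡ S (pre-costume declared): honest retirement «road closed, residual = summit»; (k4)
T3 decided «locality INSIDE at the window» re-tags the Shadow BARRIER[LOCALITY] (IDEA-NEEDED =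
non-localizing technique) — not a kill, a placement.
NOT DECOMPOSED YET. The dial step Cell 0 → Cell 1 (N ↦ N·log N + 1) is the whole open content of
Y(1) above a PROVED cell (rev 1); the weight-one/sparsity technique class has method ceiling ≈ N +
4N/L − L (lens g12 ceiling_oneShattering), so Cell 1 needs the full YES structure (all truth tables
of 2^{βn}/(cn)-size circuits) — IDEA-NEEDED. Test T3 (is gap-MCSP[2^{βn}/(cn), 2^{βn}] in
SIZE^O[N·polylog] with one oracle gate of fan-in N^{O(β)} — CHOPRS-style local upper bound AT the
window?); the q ≥ 2 cells; the T4 binder discharges; the IDLE-row located costumes as census rows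
(law (x) column); the kinship bookkeeping F_B2(a) QuadLinLB (N36) / F_B2(b) gap-MCSP window.
CHEAPEST FALSIFIER. (T_TO «trade-off law» DECIDED·PROVED g13 and LANDED rev 2 — no longer a
falsifier candidate.) Tribunal bookkeeping (rev 2, writer advisory probes 2026-08-30T14:55Z /
14:57Z, run/shared/lean/tribunal/route-PneNP-RootDecompMagnificationPayout/t0.json): `#h21_tribunal`
resolves `residual := [...]` entries LITERALLY — the short name `CircuitWindowLiftOne` is NOT a
load-bearing crux name and is ignored («ignored for roles» ⇒ t1r joint-unassigned ⇒ FAIL rc 30, the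
D26 artefact), the fully qualified
`Summit.PneNP.PneNP.Theses.RootDecompMagnificationPayout.CircuitWindowLiftOne` gives t1r
joint-declared ⇒ tk=PROVISIONAL rc 0 (t3 present: witness windowCellZero_proof clean; ambiguity
t1c-timeout (quick budget) · witness-regime-unverified (no s_case: for a law-D cut of P ≠ NP the
«S-restricted case» at the rung has no honest instance — left unset on purpose) · barrier-unmatched
(t4 placed by the CLI docstring match: natural-proofs evasion declared, GateEliminationLimit /
Locality)). In Lean: `#h21_crux_probe` on both pieces vs PneNP (run in the pack: CLEAN, C → S fails)
and the lens's 9/9 must-fail probes (critic spot-read). In print: a magnification theorem from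
N·polylog size for gap-MCSP[2^{βn}] (decides T2: OPS21, CJW20, CHOPRS20, MMW19, Chen–Li–Yang CCC
2022 searched — thresholds are N^{1+ε} for circuits, N^{2+ε}/N^{3+ε} for formulas / probabilistic
formulas; none at N·polylog for general circuits), or an N·polylog upper bound for gap-MCSP at these
parameters (kills Y(1); none known — the problem reads all N input bits and the best upper bounds
are 2^{O(2^{βn})}·poly-type exhaustive search circuits of size N^{1+o(1)} only for β → 0? open).

Novelty: Searches RUN (lens g10 NODE-g10.md §5 + critic + writer): `lean search
'gapMCSP|GapMCSPLowerBound|MagnificationHypothesis'` (tree OPS module, MagnificationGapCensus rows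
gap_R3 / gap_R42 / gap_R24 / gap_R5x, the light-cone floor theorem; hub item 13658 = exact MCSP[s]
AT the MMW threshold), `ledger negatives --problem PneNP` (stmt-PneNP-0265
Circuit2.CircuitMagnificationFrontier_refuted — a VACUITY form; avoided: this cell has the census ∀
c ≥ 1 ∃ β₀ ∀ β shape and is non-vacuous by window_class_nonempty + the floor), corpus `lit search
--hybrid "hardness magnification gap MCSP circuit size N^{1+ε} locality barrier"` →
OliveiraPichSanthanam2021 Thm 1.4, OliveiraSanthanam2018 (FOCS), McKayMurrayWilliams2019 Thm
1.3/1.4, ChenJinWilliams2020 p.4 + Thm 1.1.1, arXiv:1911.08297 CHOPRS20 §5.2.2, Chen–Li–Yang CCC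
2022 p.7, FindGolovnevHirschKulikov2016, Li–Yang STOC 2022; galaxy `lit galaxy search "hardness
magnification|gap-MCSP|locality barrier" --star all` → the same cluster; no magnification theorem
for gap-MCSP[2^{βn}] from N·polylog general-circuit size and no typed payout classification relative
to P ≠ NP in print. Versus the cell's routes: hub Circuit 13658 and the census rows sit AT
thresholds (costume by LAW (x)); N3 / N7 (streaming / space), N15 OneTape, N30 ParityMagnification
are machine / uniform EXACT axes; N39 McspDepth cuts the DEPTH CLASS of exact MCSP, not a size
window of gap-MCSP; N36 ExchangeRate cuts DTIME(n^b) ⊆ SIZE(n^s) (dense, class-level; same frontier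
fami  [refs: 1911.08297, OliveiraPichSanthanam2021, OliveiraSanthanam2018, McKayMurrayWilliams2019, ChenJinWilliams2020, FindGolovnevHirschKulikov2016]

Barriers (technique_class: magnification payout laws, gap-MCSP window, law-D-carving): - technique_class: hardness magnification payout laws; explicit B2 circuit lower bounds for sparse
gap-MCSP; light-cone counting; law-D carving
- Literature.Barriers.PneNP.GateEliminationLimit (GHKK16): the located target Y(1) (> N log N gates,
explicit promise problem) is INSIDE the range where gate-elimination measures provably stall (c·N) —
the route declares this: leaf IDEA-NEEDED = a non-gate-elimination technique; the PROVED floor below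
(light-cone counting of YES instances, tree theorem) is outside gate elimination already, and the
frontier family F_B2 is booked once with N36; the residual CircuitWindowLiftOne is a declared
residual, expected inside nothing catalogued (a magnification statement).
- Literature.Barriers.PneNP.Locality (CHOPRS20, arXiv:1911.08297): UNPLACED at the window by
declaration (census test T3: does gap-MCSP[2^{βn}/(cn), 2^{βn}] have N·polylog-size circuits with
one small-fan-in oracle gate? the printed local upper bounds are at N^{1+ε}); if T3 answers YES the
Shadow is re-tagged INSIDE with evasion = non-localizing technique (the same IDEA-NEEDED leaf), if
NO the barrier does not quantify over the window.
- Literature.Barriers.PneNP.NaturalProofs (RR97): N/A for the guarded pieces by law (ix) (both are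
implications out of ¬S, and in Algorithmica the pseudorandomness hypothesis fails); it prices only
the S-free road to Y(1), and only conditionally on PRGs secure against SIZE[N log N]-natural
properties hosted at that tiny size (census test T_MP4)

sub-problem: PneNP · status: draft · opened planner-decomp-pnenp-writer-1-g5-0 2026-08-30T10:22:00Z · rev 2 · ledger route-PneNP-RootDecompMagnificationPayout
GENERATED by the gate from the ledger (D-0016/17). Provers cite these decls: `theorem foo : Summit.PneNP.PneNP.Theses.RootDecompMagnificationPayout.<Decl> := …` in Summits/PneNP/PneNP/Theorems/<Name>.lean.
-/

namespace Summit.PneNP.PneNP.Theses.RootDecompMagnificationPayout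

open scoped BigOperators Topology Manifold Classical MeasureTheory ProbabilityTheory Matrix InnerProductSpace ComplexConjugate ContinuousMap
open Filter Set Function TopologicalSpace MeasureTheory

attribute [summit_statement] _root_.PneNP

open Literature.PNP

/-- item stmt-PneNP-32096 · crux · rank 2 · open · by planner
why it might fail: Its S-free core Y(1) is an explicit super-linear B₂-circuit lower bound (for a sparse promise problem): gate elimination stops at c·N (GateEliminationLimit; records 3.01N / 3.1N), locality may bite at the window (test T3 open), and nothing is known to derive it from NP ⊆ P.
sources: OliveiraPichSanthanam2021 (Hardness magnification near state-of-the-art lower bounds, Theory of Computing 17 / CCC 2019), Thm 1.4: gap-MCSP[2^{βn}/(cn), 2^{βn}] ∉ SIZE[N^{1+ε}] ⟹ NP ⊄ P/poly; tree OliveiraPichSanthanam2019.GapMCSPLowerBound / thm14, census row gap_R3, ChenJinWilliams2019/2020 (Sharp threshold results for computational complexity, STOC 2020) p.4: no super-linear B₂ size lower bound for any MCSP variant is known; Thm 1.1.1 (census gap_R42, IDLE payout, lens verdict_R42), Literature.Barriers.PneNP.GateEliminationLimit (Golovnev–Hirsch–Knop–Kulikov MFCS 2016: gate-elimination measures stop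 at c·N); records FindGolovnevHirschKulikov2016 (3+1/86)N, Li–Yang STOC 2022 3.1N − o(N), arXiv:1911.08297 Chen–Hirahara–Oliveira–Pich–Rajgopal–Santhanam, Beyond natural proofs: hardness magnification and locality (ITCS 2020), §5.2.2 (the anti-checker route localizes); Literature.Barriers.PneNP.Locality, tree Literature.Computability.MetaComplexity.gapMCSP_not_mem_SIZEae_sublinear (GapMCSPLightConeLowerBound.lean: the PROVED floor N − ⌈N^{β′}⌉, counting YES instances against the light cone) and MagnificationGapCensus.gap_R3 / gap_R42 (cited BY NAME), HOME/decomp-pnenp-lens-1/MagnificationPayout.lean sha256 b36e8d94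
[crux r2 · piece A «SHADOW» · ATTACKED · tags WEAKER(formal: S ⟹ A, lens shadow_of_pneNP;
strictness: A → S ⟺ ¬S ∧ ¬Y(1) refutable, and ¬S yields only N^a-size separators for an unknown a —
census test T1) / NECESSARY (pack pneNP_iff) / not-COSTUME as typed (lens 9/9 must-fail probes;
writer bc7 CLEAN) / UNDECIDED / leaf IDEA-NEEDED (an explicit super-linear B₂ lower bound, here for
a sparse promise problem)] THE CUT PREDICATE Y(1) := CircuitWindowCell 1 «for every c ≥ 1 there is
β₀ > 0 such that for all β ∈ (0, β₀) the promise problem gap-MCSP[2^{βn}/(cn), 2^{βn}] (OPS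
parameters, tree yesBound / noBound) is NOT separated by B₂-circuit families of eventually ≤ N·⌊log₂
N⌋ + 1 gates» — the census-R3 hypothesis shape with OPS's threshold size ⌊N^{1+ε}⌋ replaced by the
WINDOW size N log N; DIAL q ↦ N·⌊log₂N⌋^q + q (lens cell_anti: antitone in q), every cell BELOW
every threshold instance (lens windowBound_eventually_le_sizeBound, windowLB_of_lowerBound,
cell_of_gap_R3 = aside WindowBelowThreshold PROVED) and ABOVE the PROVED floor N − ⌈N^{β′}⌉ (aside
WindowFloor PROVED = tree gapMCSP_not_mem_SIZEae_sublinear); non-vacuous (lens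
window_class_nonempty). OPEN for every q: no super-linear -/
@[route_item "route-PneNP-RootDecompMagnificationPayout", crux]
def CircuitWindowShadowOne : Prop :=
  ¬ PneNP → ∀ c : ℕ, 1 ≤ c → ∃ β₀ : ℝ, 0 < β₀ ∧ ∀ β : ℝ, 0 < β → β < β₀ → Literature.Computability.MetaComplexity.gapMCSP (Literature.Computability.MetaComplexity.OliveiraPichSanthanam2019.yesBound c β) (Literature.Computability.MetaComplexity.OliveiraPichSanthanam2019.noBound β) ∉ Literature.Computability.Complexity.promiseLift (Literature.Computability.MetaComplexity.SIZEae (fun N : ℕ => N * Nat.log 2 N ^ 1 + 1))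

/-- item stmt-PneNP-32097 · crux · rank 3 · open · by planner
why it might fail: Pre-costume in expectation: if Y(1) is simply true (believed: PRFs), the Lift is S itself; as a theorem it would be magnification from N·log N for gap-MCSP, below OPS's N^{1+ε} kernelization — the anti-checker / kernel arguments need N^{ε} room (CHOPRS20 §5), so T2 may be out of reach or false.
sources: OliveiraPichSanthanam2021 (Hardness magnification near state-of-the-art lower bounds, Theory of Computing 17 / CCC 2019), Thm 1.4: gap-MCSP[2^{βn}/(cn), 2^{βn}] ∉ SIZE[N^{1+ε}] ⟹ NP ⊄ P/poly; tree OliveiraPichSanthanam2019.GapMCSPLowerBound / thm14, census row gap_R3, McKayMurrayWilliams2019 (Weak lower bounds on resource-bounded compression imply strong separations, STOC 2019), Thm 1.3 / Thm 1.4; hub item stmt-PneNP-13658 (exact MCSP[s] at the MMW threshold, cited BY NAME), arXiv:1911.08297 Chen–Hirahara–Oliveira–Pich–Rajgopal–Santhanam, Beyond natural proofs: hardness magnification and locality (ITCS 2020), §5.2.2 (the anti-checker route localizes); Literature.Barriers.PneNP.Locality, ChenJinWilliams2019/2020 (Sharp threshold results for computational complexity, STOC 2020) p.4: no super-linear B₂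 size lower bound for any MCSP variant is known; Thm 1.1.1 (census gap_R42, IDLE payout, lens verdict_R42), HOME/decomp-pnenp-lens-1/MagnificationPayout.lean sha256 b36e8d94, HOME/decomp-pnenp-lens-1/NODE-g10.md sha256 2c68d1f2
[crux r3 · piece B «LIFT» (law-D form; ⟺ (Y(1) → S), pack liftOne_iff_imp) · DECLARED RESIDUAL
(tribunal_fit.residual; fallback label; PRE-COSTUME IN EXPECTATION declared: Y(1) is believed TRUE
S-free and if Y(1) holds the Lift IS S — lineage invariant NODE-g9 §3; NO residual score claimed) ·
tags WEAKER(formal: S ⟹ B, lens lift_of_pneNP; strictness: it is MAGNIFICATION FROM N log N for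
gap-MCSP[2^{βn}/(cn), 2^{βn}], below every printed threshold for this problem — census test T2) /
NECESSARY / not-COSTUME as typed (probes fail) / UNDECIDED / leaf IDEA-NEEDED (test T2: kernelize
gap-MCSP[2^{βn}] into N·polylog gates + one oracle gate, i.e. improve OPS Thm 1.4's threshold from
N^{1+ε} to N·polylog, or transport MMW Thm 1.4's s = polylog regime) · residual] THE CUT PREDICATE
Y(1) := CircuitWindowCell 1 «for every c ≥ 1 there is β₀ > 0 such that for all β ∈ (0, β₀) the
promise problem gap-MCSP[2^{βn}/(cn), 2^{βn}] (OPS parameters, tree yesBound / noBound) is NOT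
separated by B₂-circuit families of eventually ≤ N·⌊log₂ N⌋ + 1 gates» — the census-R3 hypothesis
shape with OPS's threshold size ⌊N^{1+ε}⌋ replaced by the WINDOW size N log N; DIAL q ↦ N·⌊log₂N⌋^q
+ q (lens cell_anti: antiton -/
@[route_item "route-PneNP-RootDecompMagnificationPayout", crux]
def CircuitWindowLiftOne : Prop :=
  ¬ PneNP → ¬ (∀ c : ℕ, 1 ≤ c → ∃ β₀ : ℝ, 0 < β₀ ∧ ∀ β : ℝ, 0 < β → β < β₀ → Literature.Computability.MetaComplexity.gapMCSP (Literature.Computability.MetaComplexity.OliveiraPichSanthanam2019.yesBound c β) (Literature.Computability.MetaComplexity.OliveiraPichSanthanam2019.noBound β) ∉ Literature.Computability.Complexity.promiseLift (Literature.Computability.MetaComplexity.SIZEae (fun N : ℕ => N * Nat.log 2 N ^ 1 + 1)))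

/-- item stmt-PneNP-32098 · aside · rank 9 · closed · proved by Summit.PneNP.PneNP.Theorems.windowFloor_proof (prover) · by planner
why it might fail: Proved (pack windowFloor_holds, axioms propext / Classical.choice / Quot.sound); the only risk is a future refactor of the tree's gapMCSP / SIZEae conventions.
sources: tree Literature.Computability.MetaComplexity.gapMCSP_not_mem_SIZEae_sublinear (GapMCSPLightConeLowerBound.lean: the PROVED floor N − ⌈N^{β′}⌉, counting YES instances against the light cone) and MagnificationGapCensus.gap_R3 / gap_R42 (cited BY NAME), HOME/decomp-pnenp-lens-1/MagnificationPayout.lean sha256 b36e8d94, writer folder/n40_magpay/N40_items.lean sha256 a94e3873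
[aside · BC5 FLOOR RUNG, PROVED in the pack (windowFloor_holds := tree
gapMCSP_not_mem_SIZEae_sublinear, lens rung_sublinear) · never staffed, never counted (bc6 aside)]
«for 0 ≤ β < β′ < 1 and every c, gap-MCSP[2^{βn}/(cn), 2^{βn}] is not separated by B₂ circuits of N
− ⌈N^{β′}⌉ gates» — counting YES instances against the light cone of a sublinear circuit. It is the
decided rung directly BELOW the window (the cell's lower calibration; the S-analogue at this budget
is not a known regime of S), and with WindowBelowThreshold it brackets the cut inside (N − o(N),
N^{1+ε}). PROVENANCE: root-decomposition cell decomp-pnenp (D-0178), proposal P39 = lens-1 gen 10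
NODE «RootDecompMagnificationPayout / WHICH MAGNIFICATION PAYS WHAT»
(HOME/decomp-pnenp-lens-1/MagnificationPayout.lean sha256 b36e8d94;
HOME/decomp-pnenp-lens-1/NODE-g10.md sha256 2c68d1f2); critic decomp-pnenp-crit-1 g4 NODE-VERDICT
2026-08-30T09:05:37Z CLEARED (0 blocking objections) on BOTH legs: LAW (x) «magnification payout»
(kernel payout classification IDLE / EXACT / OVERSHOOT of the typed MagnificationGapCensus rows
relative to S; dedup instrument) and the R3 WINDOW CELL = S-INERT LOCATED CELL strictly below an
OVERSHOOT -/
@[route_item "route-PneNP-RootDecompMagnificationPayout"]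
def WindowFloor : Prop :=
  ∀ (c : ℕ) (β β' : ℝ), 0 ≤ β → β < β' → β' < 1 → Literature.Computability.MetaComplexity.gapMCSP (Literature.Computability.MetaComplexity.OliveiraPichSanthanam2019.yesBound c β) (Literature.Computability.MetaComplexity.OliveiraPichSanthanam2019.noBound β) ∉ Literature.Computability.Complexity.promiseLift (Literature.Computability.MetaComplexity.SIZEae (fun N : ℕ => N - ⌈(N : ℝ) ^ β'⌉₊))

-- `WindowFloor` holds: proved by `Summit.PneNP.PneNP.Theorems.windowFloor_proof` (its module imports this route file, so no `_holds` link can be stated here).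

/-- item stmt-PneNP-32099 · aside · rank 9 · closed · proved by Summit.PneNP.PneNP.Theorems.windowBelowThreshold_proof (prover) · by planner
why it might fail: Proved (pack windowBelowThreshold_holds); no risk beyond convention refactors of OliveiraPichSanthanam2019.sizeBound / MagnificationHypothesis.
sources: OliveiraPichSanthanam2021 (Hardness magnification near state-of-the-art lower bounds, Theory of Computing 17 / CCC 2019), Thm 1.4: gap-MCSP[2^{βn}/(cn), 2^{βn}] ∉ SIZE[N^{1+ε}] ⟹ NP ⊄ P/poly; tree OliveiraPichSanthanam2019.GapMCSPLowerBound / thm14, census row gap_R3, tree Literature.Computability.MetaComplexity.gapMCSP_not_mem_SIZEae_sublinear (GapMCSPLightConeLowerBound.lean: the PROVED floor N − ⌈N^{β′}⌉, counting YES instances against the light cone) and MagnificationGapCensus.gap_R3 / gap_R42 (cited BY NAME), HOME/decomp-pnenp-lens-1/MagnificationPayout.lean sha256 b36e8d94, writer folder/n40_magpay/N40_items.lean sha256 a94e3873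
[aside · THRESHOLD ⟹ CELL, PROVED in the pack (windowBelowThreshold_holds := lens cell_of_gap_R3 1:
real asymptotics N·(log N)^q + q ≤ N^{1+ε} eventually, windowBound_eventually_le_sizeBound, then
monotonicity of promiseLift ∘ SIZEae) · never staffed (bc6 aside)] «OPS's magnification hypothesis
gap_R3 (∀ c ≥ 1, size ⌊N^{1+ε}⌋) implies the window cell Y(1)»: the cut sits STRICTLY BELOW the
OVERSHOOT threshold, which is what LAW (x) requires of a located cell (at threshold the shadow is
costume: lens verdict_R3_threshold). Converse fails numerically (N log N ≪ N^{1+ε}). PROVENANCE: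
root-decomposition cell decomp-pnenp (D-0178), proposal P39 = lens-1 gen 10 NODE
«RootDecompMagnificationPayout / WHICH MAGNIFICATION PAYS WHAT»
(HOME/decomp-pnenp-lens-1/MagnificationPayout.lean sha256 b36e8d94;
HOME/decomp-pnenp-lens-1/NODE-g10.md sha256 2c68d1f2); critic decomp-pnenp-crit-1 g4 NODE-VERDICT
2026-08-30T09:05:37Z CLEARED (0 blocking objections) on BOTH legs: LAW (x) «magnification payout»
(kernel payout classification IDLE / EXACT / OVERSHOOT of the typed MagnificationGapCensus rows
relative to S; dedup instrument) and the R3 WINDOW CELL = S-INERT LOCATED CELL strictly below an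
OVERSHOOT t -/
@[route_item "route-PneNP-RootDecompMagnificationPayout"]
def WindowBelowThreshold : Prop :=
  Literature.Computability.MetaComplexity.MagnificationGapCensus.gap_R3 → ∀ c : ℕ, 1 ≤ c → ∃ β₀ : ℝ, 0 < β₀ ∧ ∀ β : ℝ, 0 < β → β < β₀ → Literature.Computability.MetaComplexity.gapMCSP (Literature.Computability.MetaComplexity.OliveiraPichSanthanam2019.yesBound c β) (Literature.Computability.MetaComplexity.OliveiraPichSanthanam2019.noBound β) ∉ Literature.Computability.Complexity.promiseLift (Literature.Computability.MetaComplexity.SIZEae (fun N : ℕ => N * Nat.log 2 N ^ 1 + 1))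

-- `WindowBelowThreshold` holds: proved by `Summit.PneNP.PneNP.Theorems.windowBelowThreshold_proof` (its module imports this route file, so no `_holds` link can be stated here).

/-- item stmt-PneNP-33309 · aside · rank 9 · closed · proved by Summit.PneNP.PneNP.Theorems.windowCellZero_proof (prover) · by planner
sources: OliveiraPichSanthanam2021, arXiv:1911.08297, Jukna2012, HOME/decomp-pnenp-lens-1/TradeOffLaw.lean, HOME/decomp-pnenp-lens-1/NODE-g13.md, HOME/critic/L1_TradeOffLaw_g13_probe.lean
[aside] WindowCellZero — the q = 0 LEAF of the window dial, PROVED (lens-1 g13 «TradeOffLaw»,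
HOME/decomp-pnenp-lens-1/TradeOffLaw.lean 880b490f: tradeOffLaw_holds, c = 9 — every B₂-circuit
accepting 0^N and every e_p has G ≥ N + N/(9L) − L − 3, L = ⌊log₂ acc⌋ — ⟹ circuitWindowCell_zero,
hyp-free, standard axioms; critic NODE-VERDICT 2026-08-30T13:09:32Z CLEARED, probe
cell_zero_item_shape = this exact text, landing endorsed): «∀ c ≥ 1 ∃ β₀ > 0 ∀ β ∈ (0, β₀):
gap-MCSP[2^{βn}/(cn), 2^{βn}] is not separated by B₂ circuits of eventually ≤ N·⌊log₂N⌋^0 + 0 = N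
gates» (= lens CircuitWindowCell 0 by Iff.rfl; β₀ = 1/3; tree spelling gapMCSP_R3_not_mem_SIZEae_id,
writer sketch windowCellZero_iff_id). BC5 RUNG for 32096 STRICTLY between the floor WindowFloor
(32098, N − ⌈N^{β′}⌉) and the crux cell q = 1 (N·log N + 1): the open content of
CircuitWindowShadowOne is now exactly the dial step N ↦ N·log N + 1 (critic pricing_edge); method
ceiling of the weight-one class ≈ N + 4N/L − L. At q = 0 the bet is DECIDED: Lift 0 ↔ S, Shadow 0
free (bet_zero). Never staffed (bc6 aside); closes when GapMCSPWindowCellZero.lean lands (--supports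
32096). -/
@[route_item "route-PneNP-RootDecompMagnificationPayout"]
def WindowCellZero : Prop :=
  ∀ c : ℕ, 1 ≤ c → ∃ β₀ : ℝ, 0 < β₀ ∧ ∀ β : ℝ, 0 < β → β < β₀ → Literature.Computability.MetaComplexity.gapMCSP (Literature.Computability.MetaComplexity.OliveiraPichSanthanam2019.yesBound c β) (Literature.Computability.MetaComplexity.OliveiraPichSanthanam2019.noBound β) ∉ Literature.Computability.Complexity.promiseLift (Literature.Computability.MetaComplexity.SIZEae (fun N : ℕ => N * Nat.log 2 N ^ 0 + 0))

-- `WindowCellZero` holds: proved by `Summit.PneNP.PneNP.Theorems.windowCellZero_proof` (its module imports this route file, so no `_holds` link can be stated here).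

/-- item stmt-PneNP-32100 · assembly · rank 1 · open · by planner
why it might fail: Cannot fail: closes is two lines of propositional logic, certified native by route check.
sources: HOME/decomp-pnenp-lens-1/MagnificationPayout.lean sha256 b36e8d94, writer folder/n40_magpay/N40_items.lean sha256 a94e3873
[assembly] law-D frame: under ¬S the Shadow gives Y(1) and the Lift gives ¬Y(1) — glue.lean `closes`
(by_contra; both binders used, two lines, hypothesis-free); exactness `pneNP_iff : PneNP ↔ ShadowOne
∧ LiftOne` in the pack (= lens node_iff 1). PROVENANCE: root-decomposition cell decomp-pnenp
(D-0178), proposal P39 = lens-1 gen 10 NODE «RootDecompMagnificationPayout / WHICH MAGNIFICATION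
PAYS WHAT» (HOME/decomp-pnenp-lens-1/MagnificationPayout.lean sha256 b36e8d94;
HOME/decomp-pnenp-lens-1/NODE-g10.md sha256 2c68d1f2); critic decomp-pnenp-crit-1 g4 NODE-VERDICT
2026-08-30T09:05:37Z CLEARED (0 blocking objections) on BOTH legs: LAW (x) «magnification payout»
(kernel payout classification IDLE / EXACT / OVERSHOOT of the typed MagnificationGapCensus rows
relative to S; dedup instrument) and the R3 WINDOW CELL = S-INERT LOCATED CELL strictly below an
OVERSHOOT threshold, scored once under cap (vii) on the coordinate «B₂-size window of
gap-MCSP[2^{βn}/(cn), 2^{βn}] between the proved floor N − ⌈N^{β′}⌉ and the OPS threshold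
⌊N^{1+ε}⌋»; NO residual score; HOME/critic/L1_MagnificationPayout_g10_probe.lean sha256 88360aa8
farm rc0 / 0 sorry / 58 AXOK; birth ruling W1 THIN ROUTE LOW priori -/
@[route_item "route-PneNP-RootDecompMagnificationPayout"]
def Assembly : Prop :=
  CircuitWindowShadowOne → CircuitWindowLiftOne → PneNP

/-! D-0027 §2.1 — DECIDING THEOREM (planner-authored via `route open/edit --closes-file`; by planner-decomp-pnenp-writer-1-g5-0 2026-08-30T10:22:00Z):
its hypotheses are this route's items and its conclusion the sub-problem Statement (glue_lint), and it elaborates with this file. -/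

@[closes "route-PneNP-RootDecompMagnificationPayout"] theorem closes (h₁ : CircuitWindowShadowOne) (h₂ : CircuitWindowLiftOne) : _root_.PneNP := by
  by_contra hS
  exact h₂ hS (h₁ hS)

end Summit.PneNP.PneNP.Theses.RootDecompMagnificationPayout
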